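import Mathlib
import Summits.Schanuel.Schanuel.Theorems.RigidCoreMinimalCounterexampleInAclLogSector
import Summits.Schanuel.Schanuel.Theorems.AclSubsetLogFreeCore.Negative.ExpAclDefinability
import Literature.ModelTheory.ExponentialFields.DefinabilityParams

/-!
# The MIXED-SECTOR BRIDGE for (S*) — crux stmt-Schanuel-0969 `RigidCore.MinimalCounterexampleInAcl`

Line `kernel-arithmetic-selection`, stub `stub_mixedBridge` (gen 12 mixed-sector bridge),
`--supports stmt-Schanuel-0969`.

For a tuple `x : Fin n → ℂ` and an integer vector `M : Fin n → ℤ` put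
`E = {Σᵢ Mᵢ x'ᵢ : x' ∈ locusMates x}`, the set of values of the integer combination `M` on the
MATES of `x` (the ℚ-linearly independent tuples `x'` such that `(x', e^{x'})` satisfies every
ℚ-polynomial relation of `(x, eˣ)`).  Two structural facts about `E`, for EVERY `x` and `M`:

* `E` is `∅`-definable in `ℂ_exp = (ℂ, +, ·, −, 0, 1, exp)` (`intCombo_locusMates_definable₁`):
  it is the projection to the first coordinate of the `∅`-definable set
  `{(s, x') | x' ∈ locusMates x ∧ s = Σᵢ Mᵢ x'ᵢ}` (the mate set is `∅`-definable, tree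
  `locusMates_definable`; integer numerals are terms; `Set.Definable.exists_of_finite`).
* If `e^{Σ Mᵢxᵢ}` is algebraic, a root of `p ∈ ℚ[T] ∖ 0`, then `exp '' E ⊆ {roots of p}` is finite
  (`cexp_image_intCombo_locusMates_finite`): writing `M = M⁺ − M⁻` with `M± ≥ 0`, the
  HOMOGENISED relation `R = Σⱼ pⱼ · (∏ Yᵢ^{M⁺ᵢ})ʲ · (∏ Yᵢ^{M⁻ᵢ})^{d−j} ∈ ℚ[X, Y]` (`d = deg p`)
  evaluates at any point `(z, eᶻ)` to `N_z^d · p(e^{Σ Mᵢzᵢ})` with `N_z = e^{Σ M⁻ᵢzᵢ} ≠ 0`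
  (`aeval_expPoint_homogenised`), so `R` is a relation of `(x, eˣ)`, hence of every
  `(x', e^{x'})` with `x'` a mate, hence `p(e^{Σ Mᵢx'ᵢ}) = 0`.

The registered stub `stub_mixedBridge` is the case `n = 2`.  In the line these feed the coset
selectors on `E` (the mixed sector of the rank-2 case of (S*)).

## References

* [Marker2002] D. Marker, *Model Theory: An Introduction*, Springer GTM 217, §1.3 (definable sets
  are closed under projections and Boolean combinations).
* [Lang1966] S. Lang, *Introduction to transcendental numbers*, Addison–Wesley 1966, Ch. II §1
  (specialisation of polynomial relations; conjugates of an algebraic value are roots of the same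
  rational polynomial).
-/

noncomputable section

set_option linter.dupNamespace false

open Complex Set FirstOrder Polynomial

namespace Summit.Schanuel.Schanuel.Cruxes.MinimalCounterexampleInAcl.KernelArithmeticSelection

open Literature.ModelTheory.ExponentialFields
open Summit.Schanuel.Schanuel.Theorems.AclSubsetLogFreeCore.Negative

variable {n : ℕ}

/-! ## Definability of `E` -/

/-- Finite sums of definable functions are definable functions (in `ℂ_exp`, any parameter set).
[folklore] -/
theorem definableFun_finsetSum {α ι : Type*} {A : Set ℂ} (s : Finset ι) {g : ι → (α → ℂ) → ℂ}
    (hg : ∀ i ∈ s, A.DefinableFun Language.expRing (g i)) :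
    A.DefinableFun Language.expRing (fun v => ∑ i ∈ s, g i v) := by
  classical
  induction s using Finset.induction_on with
  | empty => simpa using (definableFun_zero' (A := A) (α := α))
  | insert a s ha ih =>
    have h := definableFun_add' (hg a (Finset.mem_insert_self a s))
      (ih fun i hi => hg i (Finset.mem_insert_of_mem hi))
    simpa [Finset.sum_insert ha] using h

/-- The set `{(s, x') | x' ∈ locusMates x ∧ s = Σᵢ Mᵢ x'ᵢ}` (coordinates `Fin 1 ⊕ Fin n`) is
`∅`-definable in `ℂ_exp`. [folklore] -/
theorem intCombo_graph_locusMates_definable (x : Fin n → ℂ) (M : Fin n → ℤ) :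
    (∅ : Set ℂ).Definable Language.expRing
      {w : Fin 1 ⊕ Fin n → ℂ | w ∘ Sum.inr ∈ locusMates x ∧
        w (Sum.inl 0) = ∑ i, (M i : ℂ) * w (Sum.inr i)} := by
  refine definable_setOf_and_params ?_ ?_
  · exact (locusMates_definable x).preimage_comp Sum.inr
  · exact definable_setOf_eq_params (definableFun_proj_params _)
      (definableFun_finsetSum _ fun i _ =>
        definableFun_mul' (definableFun_intCast' _) (definableFun_proj_params _))

/-- **`E = {Σᵢ Mᵢ x'ᵢ : x' ∈ locusMates x}` is `∅`-definable in `ℂ_exp`**, for every tuple `x`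
and integer vector `M` (projection of `intCombo_graph_locusMates_definable`). [folklore] -/
theorem intCombo_locusMates_definable₁ (x : Fin n → ℂ) (M : Fin n → ℤ) :
    Set.Definable₁ (∅ : Set ℂ) Language.expRing
      {s : ℂ | ∃ x' ∈ locusMates x, s = ∑ i, (M i : ℂ) * x' i} := by
  have h := (intCombo_graph_locusMates_definable x M).exists_of_finite
  unfold Set.Definable₁
  convert h using 1
  ext v
  simp only [mem_setOf_eq, Sum.elim_comp_inr, Sum.elim_inl, Sum.elim_inr]

/-! ## Finiteness of `exp '' E` -/

/-- `∏ᵢ (e^{zᵢ})^{M⁺ᵢ} = e^{Σ Mᵢzᵢ} · ∏ᵢ (e^{zᵢ})^{M⁻ᵢ}` for the splitting `M = M⁺ − M⁻`,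
`M⁺ᵢ = (Mᵢ).toNat`, `M⁻ᵢ = (−Mᵢ).toNat`. [folklore] -/
theorem prod_cexp_pow_toNat (M : Fin n → ℤ) (z : Fin n → ℂ) :
    ∏ i, cexp (z i) ^ (M i).toNat =
      cexp (∑ i, (M i : ℂ) * z i) * ∏ i, cexp (z i) ^ (-M i).toNat := by
  rw [Complex.exp_sum, ← Finset.prod_mul_distrib]
  refine Finset.prod_congr rfl fun i _ => ?_
  rw [Complex.exp_int_mul, ← zpow_natCast, ← zpow_natCast, ← zpow_add₀ (Complex.exp_ne_zero _)]
  congr 1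
  have := Int.toNat_sub_toNat_neg (M i)
  omega

/-- HOMOGENISATION IDENTITY: `Σ_{j ≤ d} pⱼ (wN)ʲ N^{d−j} = N^d · p(w)` for `deg p ≤ d`. [folklore] -/
theorem sum_coeff_mul_pow_eq {K : Type*} [CommRing K] [Algebra ℚ K] (p : ℚ[X]) {d : ℕ}
    (hd : p.natDegree ≤ d) (w N : K) :
    ∑ j ∈ Finset.range (d + 1), algebraMap ℚ K (p.coeff j) * (w * N) ^ j * N ^ (d - j) =
      N ^ d * Polynomial.aeval w p := by
  rw [Polynomial.aeval_eq_sum_range' (Nat.lt_succ_of_le hd), Finset.mul_sum]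
  refine Finset.sum_congr rfl fun j hj => ?_
  have hjd : j ≤ d := Nat.lt_succ_iff.1 (Finset.mem_range.1 hj)
  rw [Algebra.smul_def, mul_pow, ← pow_sub_mul_pow N hjd]
  ring

/-- THE HOMOGENISED RELATION. For `p ∈ ℚ[T]` of degree `≤ d` and `M : Fin n → ℤ`, the polynomial
`R = Σⱼ pⱼ (∏ Yᵢ^{M⁺ᵢ})ʲ (∏ Yᵢ^{M⁻ᵢ})^{d−j} ∈ ℚ[X, Y]` evaluates at the point `(z, eᶻ)` to
`N_z^d · p(e^{Σ Mᵢzᵢ})`, `N_z = ∏ᵢ (e^{zᵢ})^{M⁻ᵢ}`. [folklore] -/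
theorem aeval_expPoint_homogenised (p : ℚ[X]) {d : ℕ} (hd : p.natDegree ≤ d) (M : Fin n → ℤ)
    (z : Fin n → ℂ) :
    MvPolynomial.aeval (Sum.elim z (cexp ∘ z))
        (∑ j ∈ Finset.range (d + 1), MvPolynomial.C (p.coeff j) *
          (∏ i, MvPolynomial.X (Sum.inr i) ^ (M i).toNat) ^ j *
          (∏ i, MvPolynomial.X (Sum.inr i) ^ (-M i).toNat) ^ (d - j) :
            MvPolynomial (Fin n ⊕ Fin n) ℚ) =
      (∏ i, cexp (z i) ^ (-M i).toNat) ^ d * Polynomial.aeval (cexp (∑ i, (M i : ℂ) * z i)) p := by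
  have hP : MvPolynomial.aeval (Sum.elim z (cexp ∘ z))
      (∏ i, MvPolynomial.X (Sum.inr i) ^ (M i).toNat : MvPolynomial (Fin n ⊕ Fin n) ℚ) =
      ∏ i, cexp (z i) ^ (M i).toNat := by
    simp [map_prod]
  have hN : MvPolynomial.aeval (Sum.elim z (cexp ∘ z))
      (∏ i, MvPolynomial.X (Sum.inr i) ^ (-M i).toNat : MvPolynomial (Fin n ⊕ Fin n) ℚ) =
      ∏ i, cexp (z i) ^ (-M i).toNat := by
    simp [map_prod]
  rw [map_sum]
  simp only [map_mul, map_pow, MvPolynomial.aeval_C, hP, hN, prod_cexp_pow_toNat M z]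
  exact sum_coeff_mul_pow_eq p hd _ _

/-- **`exp '' E` IS FINITE when `e^{Σ Mᵢxᵢ}` is algebraic**: every `e^{Σ Mᵢx'ᵢ}`, `x'` a mate of
`x`, is a root of the (nonzero) rational polynomial annihilating `e^{Σ Mᵢxᵢ}`, because the
homogenised relation is a ℚ-polynomial relation of `(x, eˣ)` and mates satisfy all of those.
[folklore] -/
theorem cexp_image_intCombo_locusMates_finite (x : Fin n → ℂ) (M : Fin n → ℤ)
    (halg : IsAlgebraic ℚ (cexp (∑ i, (M i : ℂ) * x i))) :
    (cexp '' {s : ℂ | ∃ x' ∈ locusMates x, s = ∑ i, (M i : ℂ) * x' i}).Finite := by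
  obtain ⟨p, hp0, hpx⟩ := halg
  have hN : ∀ z : Fin n → ℂ, (∏ i, cexp (z i) ^ (-M i).toNat) ^ p.natDegree ≠ 0 := fun z =>
    pow_ne_zero _ (Finset.prod_ne_zero_iff.2 fun i _ => pow_ne_zero _ (Complex.exp_ne_zero _))
  refine (p.rootSet_finite ℂ).subset ?_
  rintro _ ⟨s, ⟨x', hx', rfl⟩, rfl⟩
  rw [Polynomial.mem_rootSet_of_ne hp0]
  have hRx := aeval_expPoint_homogenised p le_rfl M x
  rw [hpx, mul_zero] at hRx
  have h := hx'.2 _ hRx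
  rw [aeval_expPoint_homogenised p le_rfl M x'] at h
  exact (mul_eq_zero.1 h).resolve_left (hN x')

/-! ## The registered stub -/

/-- **Stub S3 — THE MIXED-SECTOR BRIDGE (registered stub `stub_mixedBridge`, PROVED).** For a pair
`x : Fin 2 → ℂ` and `M : Fin 2 → ℤ` with `e^{M₀x₀ + M₁x₁}` algebraic, the set
`E = {M₀x'₀ + M₁x'₁ : x' ∈ locusMates x}` of values of the combination on the mates of `x` is
`∅`-definable in `ℂ_exp` and has finitely many exponentials (all roots of the rational polynomial
annihilating `e^{M₀x₀ + M₁x₁}`).  No hypothesis on `x` (nor `M ≠ 0`) is needed. [folklore] -/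
theorem stub_mixedBridge : ∀ (x : Fin 2 → ℂ) (M : Fin 2 → ℤ), IsAlgebraic ℚ (Complex.exp (∑ i, (M i : ℂ) * x i)) → Set.Definable₁ (∅ : Set ℂ) Literature.ModelTheory.ExponentialFields.Language.expRing {s : ℂ | ∃ x' ∈ Summit.Schanuel.Schanuel.Cruxes.MinimalCounterexampleInAcl.KernelArithmeticSelection.locusMates x, s = ∑ i, (M i : ℂ) * x' i} ∧ (Complex.exp '' {s : ℂ | ∃ x' ∈ Summit.Schanuel.Schanuel.Cruxes.MinimalCounterexampleInAcl.KernelArithmeticSelection.locusMates x, s = ∑ i, (M i : ℂ) * x' i}).Finite := by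
  intro x M halg
  exact ⟨intCombo_locusMates_definable₁ x M, cexp_image_intCombo_locusMates_finite x M halg⟩

end Summit.Schanuel.Schanuel.Cruxes.MinimalCounterexampleInAcl.KernelArithmeticSelection

end
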